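import Mathlib
import Literature.Analysis.TotalPositivity.MultiplyPositiveProofs
import Literature.LinearAlgebra.Matrix.GramDeterminantKernel
import Summits.ValiantsHypothesis.ValiantsHypothesis.Theorems.LacunarySymmetroidMatrixDescartesStubDetCurve
import Summits.ValiantsHypothesis.ValiantsHypothesis.Theorems.LacunarySymmetroidMatrixDescartesDetLorentzianNonneg
import HarnessLib

/-!
# ValiantsHypothesis / LacunarySymmetroid — crux `MatrixDescartes` (stmt-ValiantsHypothesis-18050, V1),
# line `Cruxes/MatrixDescartes/Lines/lorentzian_shadow.lean`: the DEFINITE case of `DetLorentzian` —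
# positive coefficients on the whole layer and M-convex support

The line's KNOWN stub `stub_detLorentzian : DetLorentzian` ("`det Σ_l s_l A_l` with `A_l ⪰ 0` is Lorentzian",
Borcea–Brändén 2009 Prop. 2.4 + Brändén–Huh 2020 §2) asks for `IsLorentzianArray m K (detArray m K A)`: (a)
`c_α ≥ 0`, (b) `c_α = 0` off the layer `Δ(m,K) = {Σ α = m}`, (c) M-convex support (Murota's exchange axiom,
the line's `IsMConvexOn … (fun _ => 0)`), (d) Lorentz signature of the Hessians `hessAt c γ`, where
`c_α = [s^α] det Σ_l s_l A_l` (`detArray`).  Clauses (a), (b) for PSD `A_l` are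
`Theorems/LacunarySymmetroidMatrixDescartesDetLorentzianNonneg.lean` (val-lit-p7).  THIS FILE does the positive
DEFINITE case (`0` named facts, no definitions):

* `det_eq_sum_sq` — CAUCHY–BINET SUM-OF-SQUARES FORM `det Σ_l s_l B_lᵀB_l = Σ_T (∏_{r∈T} s_{blk r})·det(B_T)²`
  over the `m`-subsets `T` of the `Km` stacked rows (tree: `Literature.Analysis.TotalPositivity.det_mul_eq_sum_strictMono`);
* `exists_indepRows` — GREEDY ROW SELECTION: if the rows of every block span `ℝ^m`, then for every profile
  `β` with `Σ β ≤ m` there are `Σ β` linearly independent stacked rows, `β_l` of them in block `l`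
  (rank exchange: a spanning block always has a row outside a proper span);
* `coeff_det_gram_pos`, **`detArray_pos_of_posDef`** (b′) — for `A_l ≻ 0` (Gram `A_l = B_lᵀB_l` with `B_l`
  INVERTIBLE, `Literature.LinearAlgebra.Matrix.exists_eq_conjTranspose_mul_self_of_posSemidef` + `det A_l > 0`)
  EVERY coefficient on the layer is `> 0`: one Cauchy–Binet term with row profile `α` is a nonzero square, all
  others are squares;
* `exch_mem_layer`, **`isLorentzianArray_parts_abc_of_posDef`** (c-definite) — hence the support is the whole layer,
  which satisfies the exchange axiom, so conjuncts (a)(b)(c) of `IsLorentzianArray m K (detArray m K A)` hold for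
  `A_l ≻ 0`, stated in the line's currency with `detArray / layer / exch / IsMConvexOn` UNFOLDED (the line file is
  not importable from `Theorems/`; the line closes them by `exact`).

Residual of `stub_detLorentzian` after this file and p7's: (d) the Hessian signature `AtMostOnePosEig (hessAt c γ)`
(Gårding hyperbolicity of `det` on the PSD cone + Brändén–Huh "stable ⇒ Lorentzian"), and (c) for SINGULAR PSD
tuples (support = lattice points of a generalized permutohedron, the polymatroid rank condition
`c_α ≠ 0 ⟺ ∀ S, Σ_{l∈S} α_l ≤ rank Σ_{l∈S} A_l`).  Honest framing: helper lemmas on an unregistered ALTERNATIVE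
line of the V1 crux; `stub_detLorentzian`, `stub_lorentzianDescartes`, `MatrixDescartes`, Conjecture B and
`VP ≠ VNP` stay OPEN / NOT proved.
-/

-- `Summit.ValiantsHypothesis.ValiantsHypothesis.…` is the tree's mandated single-conjunct layout (Sub = Summit).
set_option linter.dupNamespace false

noncomputable section

namespace Summit.ValiantsHypothesis.ValiantsHypothesis.Theorems.LacunarySymmetroidMatrixDescartes

open Matrix Finset
open scoped BigOperators MatrixOrder

namespace DetLorentzianDefinite

variable {K m : ℕ}

/-! ### Monomial bookkeeping -/

/-- The coefficient of `s^d` in `(∏_c s_{f c}) · r · r` is `r²` if the exponent count of `f` is `d`, else `0`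
(`DetLorentzian.prod_X_eq_monomial`). [folklore] -/
theorem coeff_prod_X_mul (f : Fin m → Fin K) (r : ℝ) (d : Fin K →₀ ℕ) :
    MvPolynomial.coeff d ((∏ c, (MvPolynomial.X (f c) : MvPolynomial (Fin K) ℝ)) *
        (MvPolynomial.C r * MvPolynomial.C r)) =
      if (∑ c, Finsupp.single (f c) 1) = d then r * r else 0 := by
  classical
  rw [DetLorentzian.prod_X_eq_monomial, ← map_mul, mul_comm, MvPolynomial.C_mul_monomial, mul_one,
    MvPolynomial.coeff_monomial]

/-- The exponent count of `f` at `l` is the number of indices mapped to `l`. [folklore] -/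
theorem sum_single_apply (f : Fin m → Fin K) (l : Fin K) :
    (∑ c, Finsupp.single (f c) (1 : ℕ)) l = (Finset.univ.filter fun c => f c = l).card := by
  classical
  rw [Finsupp.coe_finsetSum, Finset.sum_apply]
  simp only [Finsupp.single_apply]
  rw [Finset.card_filter]

/-! ### The Cauchy–Binet sum of squares -/

/-- Entries of the Gram pencil `Σ_l s_l • B_lᵀ B_l`: `Σ_l s_l Σ_r B_l(r,i) B_l(r,j)`, re-summed over the `Km` stacked
rows. [folklore] -/
theorem gramPencil_apply (B : Fin K → Matrix (Fin m) (Fin m) ℝ) (i j : Fin m) :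
    (∑ l, (MvPolynomial.X l : MvPolynomial (Fin K) ℝ) •
        ((B l)ᵀ * B l).map (MvPolynomial.C : ℝ →+* MvPolynomial (Fin K) ℝ)) i j =
      ∑ r : Fin (K * m), MvPolynomial.X (finProdFinEquiv.symm r).1 *
        MvPolynomial.C (B (finProdFinEquiv.symm r).1 (finProdFinEquiv.symm r).2 i) *
          MvPolynomial.C (B (finProdFinEquiv.symm r).1 (finProdFinEquiv.symm r).2 j) := by
  rw [DetCurve.genericPencil_apply]
  -- re-sum over `Fin K × Fin m` through `finProdFinEquiv`
  conv_rhs => rw [← Equiv.sum_comp finProdFinEquiv]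
  simp only [Equiv.symm_apply_apply]
  rw [Fintype.sum_prod_type]
  refine Finset.sum_congr rfl fun l _ => ?_
  rw [Matrix.mul_apply, map_sum, Finset.mul_sum]
  refine Finset.sum_congr rfl fun r _ => ?_
  rw [Matrix.transpose_apply, map_mul]
  ring

/-- **Cauchy–Binet sum-of-squares form.** For real `m × m` matrices `B_l`,
`det (Σ_l s_l • B_lᵀ B_l) = Σ_t (∏_c s_{blk (t c)}) · C(det B_t) · C(det B_t)` over the strictly increasing
selections `t : Fin m → Fin (K m)` of stacked rows (`B_t` the selected `m × m` submatrix of the stacked `B`).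
[folklore] -/
theorem det_eq_sum_sq (B : Fin K → Matrix (Fin m) (Fin m) ℝ) :
    (∑ l, (MvPolynomial.X l : MvPolynomial (Fin K) ℝ) •
        ((B l)ᵀ * B l).map (MvPolynomial.C : ℝ →+* MvPolynomial (Fin K) ℝ)).det =
      ∑ t ∈ (Finset.univ : Finset (Fin m → Fin (K * m))).filter (fun t => StrictMono t),
        (∏ c, (MvPolynomial.X (finProdFinEquiv.symm (t c)).1 : MvPolynomial (Fin K) ℝ)) *
          (MvPolynomial.C (Matrix.det (Matrix.of fun c a : Fin m =>
              B (finProdFinEquiv.symm (t c)).1 (finProdFinEquiv.symm (t c)).2 a)) *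
            MvPolynomial.C (Matrix.det (Matrix.of fun c a : Fin m =>
              B (finProdFinEquiv.symm (t c)).1 (finProdFinEquiv.symm (t c)).2 a))) := by
  classical
  -- the two factors `P (m × Km)` and `Q (Km × m)`
  set Bs : Matrix (Fin (K * m)) (Fin m) ℝ :=
    Matrix.of fun r a => B (finProdFinEquiv.symm r).1 (finProdFinEquiv.symm r).2 a with hBs
  set P : Matrix (Fin m) (Fin (K * m)) (MvPolynomial (Fin K) ℝ) :=
    Matrix.of fun a r => MvPolynomial.X (finProdFinEquiv.symm r).1 * MvPolynomial.C (Bs r a) with hP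
  set Q : Matrix (Fin (K * m)) (Fin m) (MvPolynomial (Fin K) ℝ) :=
    Matrix.of fun r a => MvPolynomial.C (Bs r a) with hQ
  have hPQ : P * Q = ∑ l, (MvPolynomial.X l : MvPolynomial (Fin K) ℝ) •
      ((B l)ᵀ * B l).map (MvPolynomial.C : ℝ →+* MvPolynomial (Fin K) ℝ) := by
    refine Matrix.ext fun i j => ?_
    rw [gramPencil_apply, Matrix.mul_apply]
    refine Finset.sum_congr rfl fun r _ => ?_
    simp only [hP, hQ, hBs, Matrix.of_apply]
  rw [← hPQ, Literature.Analysis.TotalPositivity.det_mul_eq_sum_strictMono]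
  refine Finset.sum_congr rfl fun t _ => ?_
  -- `det (P.submatrix id t) = (∏_c X_{blk(t c)}) · det (Q.submatrix t id)ᵀ`
  have hPsub : P.submatrix id t = Matrix.of fun a c =>
      (MvPolynomial.X (finProdFinEquiv.symm (t c)).1 : MvPolynomial (Fin K) ℝ) * (Q.submatrix t id)ᵀ a c := by
    refine Matrix.ext fun a c => ?_
    simp only [hP, hQ, Matrix.submatrix_apply, Matrix.of_apply, Matrix.transpose_apply, id]
  have hQsub : Q.submatrix t id = (MvPolynomial.C : ℝ →+* MvPolynomial (Fin K) ℝ).mapMatrix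
      (Matrix.of fun c a : Fin m => B (finProdFinEquiv.symm (t c)).1 (finProdFinEquiv.symm (t c)).2 a) := by
    refine Matrix.ext fun c a => ?_
    simp only [hQ, hBs, Matrix.submatrix_apply, Matrix.of_apply, RingHom.mapMatrix_apply, Matrix.map_apply, id]
  rw [hPsub, Matrix.det_mul_row, Matrix.det_transpose, hQsub, ← RingHom.map_det]
  ring

/-! ### Greedy selection of independent stacked rows with a prescribed block profile -/

/-- **Greedy row selection.** If the rows of every block span `ℝ^m`, then for every `n ≤ m` and every block
profile `β` with `Σ β = n` there is a set of stacked rows, `β_l` of them in block `l`, whose rows are linearly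
independent.  (Induction on `n`: a spanning block always contains a row outside the span of `< m` rows.)
[folklore] -/
theorem exists_indepRows {N : ℕ} (v : Fin N → (Fin m → ℝ)) (blk : Fin N → Fin K)
    (hspan : ∀ l, (⊤ : Submodule ℝ (Fin m → ℝ)) ≤ Submodule.span ℝ (v '' {r | blk r = l})) :
    ∀ n, n ≤ m → ∀ β : Fin K → ℕ, ∑ l, β l = n →
      ∃ S : Finset (Fin N), (∀ l, (S.filter fun r => blk r = l).card = β l) ∧
        LinearIndepOn ℝ v (S : Set (Fin N)) := by
  classical
  intro n
  induction n with
  | zero =>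
    intro _ β hβ
    refine ⟨∅, fun l => ?_, by rw [Finset.coe_empty]; exact linearIndepOn_empty ℝ v⟩
    rw [Finset.filter_empty, Finset.card_empty]
    exact (Finset.sum_eq_zero_iff.1 hβ l (Finset.mem_univ l)).symm
  | succ n ih =>
    intro hn β hβ
    -- a block with a positive count, and the profile with one fewer row there
    obtain ⟨l₀, hl₀⟩ : ∃ l₀, β l₀ ≠ 0 := by
      by_contra h
      push Not at h
      rw [Finset.sum_eq_zero (fun l _ => h l)] at hβ
      exact Nat.succ_ne_zero n hβ.symm
    have hsplit := Finset.sum_eq_add_sum_sdiff_singleton_of_mem (Finset.mem_univ l₀) β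
    have hsum' : ∑ l, Function.update β l₀ (β l₀ - 1) l = n := by
      rw [Finset.sum_update_of_mem (Finset.mem_univ l₀)]
      omega
    obtain ⟨S', hS'c, hS'i⟩ := ih (Nat.le_of_succ_le hn) _ hsum'
    have hcard : S'.card = n := by
      rw [Finset.card_eq_sum_card_fiberwise (t := Finset.univ) (f := blk)
        (fun r _ => Finset.mem_coe.2 (Finset.mem_univ _)), ← hsum']
      exact Finset.sum_congr rfl fun l _ => hS'c l
    -- a row of block `l₀` outside the span of the chosen rows
    obtain ⟨r, hr, hrspan⟩ : ∃ r, blk r = l₀ ∧ v r ∉ Submodule.span ℝ (v '' (S' : Set (Fin N))) := by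
      by_contra h
      push Not at h
      have hle : (⊤ : Submodule ℝ (Fin m → ℝ)) ≤ Submodule.span ℝ (v '' (S' : Set (Fin N))) :=
        (hspan l₀).trans (Submodule.span_le.2 (by rintro _ ⟨r', hr', rfl⟩; exact h r' hr'))
      have hfin : Module.finrank ℝ (Submodule.span ℝ (v '' (S' : Set (Fin N)))) ≤ n := by
        rw [← Finset.coe_image]
        exact (finrank_span_finset_le_card _).trans (Finset.card_image_le.trans hcard.le)
      have htop : Module.finrank ℝ (⊤ : Submodule ℝ (Fin m → ℝ)) = m := by
        rw [finrank_top, Module.finrank_fin_fun]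
      have hmono := Submodule.finrank_mono hle
      omega
    have hrS' : r ∉ S' := fun h => hrspan (Submodule.subset_span ⟨r, Finset.mem_coe.2 h, rfl⟩)
    refine ⟨insert r S', fun l => ?_, ?_⟩
    · rw [Finset.filter_insert]
      by_cases hl : l = l₀
      · subst hl
        rw [if_pos hr, Finset.card_insert_of_notMem (fun h => hrS' (Finset.mem_filter.1 h).1), hS'c,
          Function.update_self]
        omega
      · rw [if_neg (fun h => hl (h.symm.trans hr)), hS'c, Function.update_of_ne hl]
    · rw [Finset.coe_insert]
      exact hS'i.insert hrspan

/-- **A nonvanishing stacked minor with prescribed profile.** If every `B_l` is invertible and `Σ α = m`, some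
strictly increasing selection `t` of `m` stacked rows with block profile `α` has `det B_t ≠ 0`. [folklore] -/
theorem exists_strictMono_det_ne_zero (B : Fin K → Matrix (Fin m) (Fin m) ℝ) (hB : ∀ l, IsUnit (B l))
    (α : Fin K → ℕ) (hα : ∑ l, α l = m) :
    ∃ t : Fin m → Fin (K * m), StrictMono t ∧
      (∑ c, Finsupp.single (finProdFinEquiv.symm (t c)).1 (1 : ℕ)) = Finsupp.equivFunOnFinite.symm α ∧
      Matrix.det (Matrix.of fun c a : Fin m =>
        B (finProdFinEquiv.symm (t c)).1 (finProdFinEquiv.symm (t c)).2 a) ≠ 0 := by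
  classical
  obtain ⟨v, hv⟩ : ∃ v : Fin (K * m) → (Fin m → ℝ),
      v = fun r => B (finProdFinEquiv.symm r).1 (finProdFinEquiv.symm r).2 := ⟨_, rfl⟩
  obtain ⟨blk, hblk⟩ : ∃ blk : Fin (K * m) → Fin K, blk = fun r => (finProdFinEquiv.symm r).1 := ⟨_, rfl⟩
  -- the rows of each (invertible) block span `ℝ^m`
  have hspan : ∀ l, (⊤ : Submodule ℝ (Fin m → ℝ)) ≤ Submodule.span ℝ (v '' {r | blk r = l}) := by
    intro l
    have hli : LinearIndependent ℝ (B l).row := Matrix.linearIndependent_rows_iff_isUnit.2 (hB l)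
    rw [← hli.span_eq_top_of_card_eq_finrank' (by rw [Fintype.card_fin, Module.finrank_fin_fun])]
    refine Submodule.span_mono (Set.range_subset_iff.2 fun i => ⟨finProdFinEquiv (l, i), ?_, ?_⟩)
    · simp only [hblk, Set.mem_setOf_eq, Equiv.symm_apply_apply]
    · simp only [hv, Equiv.symm_apply_apply]
      rfl
  obtain ⟨S, hSc, hSi⟩ := exists_indepRows v blk hspan m le_rfl α hα
  have hcard : S.card = m :=
    calc S.card = ∑ l, (S.filter fun r => blk r = l).card :=
          Finset.card_eq_sum_card_fiberwise (fun r _ => Finset.mem_coe.2 (Finset.mem_univ _))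
      _ = ∑ l, α l := Finset.sum_congr rfl fun l _ => hSc l
      _ = m := hα
  -- enumerate `S` increasingly
  obtain ⟨t, ht⟩ : ∃ t : Fin m → Fin (K * m), t = fun c => S.orderEmbOfFin hcard c := ⟨_, rfl⟩
  have htinj : Function.Injective t := by rw [ht]; exact (S.orderEmbOfFin hcard).injective
  have htmem : ∀ c, t c ∈ S := by rw [ht]; exact fun c => Finset.orderEmbOfFin_mem S hcard c
  have himg : Finset.univ.image t = S := by
    ext r
    constructor
    · intro h
      obtain ⟨c, -, rfl⟩ := Finset.mem_image.1 h
      exact htmem c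
    · intro h
      have h' : r ∈ Set.range (S.orderEmbOfFin hcard) := by rw [Finset.range_orderEmbOfFin]; exact h
      obtain ⟨c, hc⟩ := h'
      exact Finset.mem_image.2 ⟨c, Finset.mem_univ _, by rw [ht]; exact hc⟩
  refine ⟨t, by rw [ht]; exact (S.orderEmbOfFin hcard).strictMono, ?_, ?_⟩
  · -- block profile
    ext l
    have key : ((Finset.univ.image t).filter fun r => blk r = l).card =
        (Finset.univ.filter fun c => blk (t c) = l).card := by
      rw [Finset.filter_image, Finset.card_image_of_injective _ htinj]
    rw [himg, hSc l] at key
    rw [sum_single_apply, Finsupp.coe_equivFunOnFinite_symm, key]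
    simp only [hblk]
  · -- the selected rows are independent, so the minor is a unit
    have hg : Function.Injective (fun c => (⟨t c, Finset.mem_coe.2 (htmem c)⟩ : (S : Set (Fin (K * m))))) := by
      intro c c' h
      exact htinj (congrArg Subtype.val h)
    have hli := (show LinearIndependent ℝ (fun x : (S : Set (Fin (K * m))) => v x) from hSi).comp _ hg
    have hrow : (Matrix.of fun c a : Fin m => B (finProdFinEquiv.symm (t c)).1
        (finProdFinEquiv.symm (t c)).2 a).row =
        (fun x : (S : Set (Fin (K * m))) => v x) ∘
          (fun c => (⟨t c, Finset.mem_coe.2 (htmem c)⟩ : (S : Set (Fin (K * m))))) := by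
      funext c
      simp only [hv, Function.comp_apply]
      rfl
    have hU : IsUnit (Matrix.of fun c a : Fin m => B (finProdFinEquiv.symm (t c)).1
        (finProdFinEquiv.symm (t c)).2 a) := by
      refine Matrix.linearIndependent_rows_iff_isUnit.1 ?_
      rw [hrow]
      exact hli
    exact ((Matrix.isUnit_iff_isUnit_det _).1 hU).ne_zero

/-! ### Positivity on the layer for definite tuples -/

/-- **Every layer coefficient of `det (Σ_l s_l • B_lᵀ B_l)` is positive when the `B_l` are invertible**: one
Cauchy–Binet term with row profile `α` is a nonzero square, the others are squares. [folklore] -/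
theorem coeff_det_gram_pos (B : Fin K → Matrix (Fin m) (Fin m) ℝ) (hB : ∀ l, IsUnit (B l))
    (α : Fin K → ℕ) (hα : ∑ l, α l = m) :
    0 < MvPolynomial.coeff (Finsupp.equivFunOnFinite.symm α)
      (∑ l, (MvPolynomial.X l : MvPolynomial (Fin K) ℝ) •
        ((B l)ᵀ * B l).map (MvPolynomial.C : ℝ →+* MvPolynomial (Fin K) ℝ)).det := by
  classical
  obtain ⟨t, ht, hcount, hdet⟩ := exists_strictMono_det_ne_zero B hB α hα
  rw [det_eq_sum_sq, MvPolynomial.coeff_sum]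
  refine lt_of_lt_of_le ?_ (Finset.single_le_sum (fun t' _ => ?_) (Finset.mem_filter.2 ⟨Finset.mem_univ t, ht⟩))
  · rw [coeff_prod_X_mul, if_pos hcount]
    exact mul_self_pos.2 hdet
  · rw [coeff_prod_X_mul]
    split_ifs
    · exact mul_self_nonneg _
    · exact le_rfl

/-- A real positive definite matrix is a Gram matrix `Sᵀ S` with `S` invertible (`S = √A`). [folklore] -/
theorem exists_gram_of_posDef {A : Matrix (Fin m) (Fin m) ℝ} (hA : A.PosDef) :
    ∃ S : Matrix (Fin m) (Fin m) ℝ, A = Sᵀ * S ∧ IsUnit S := by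
  obtain ⟨S, hS⟩ :=
    Literature.LinearAlgebra.Matrix.exists_eq_conjTranspose_mul_self_of_posSemidef hA.posSemidef
  rw [Matrix.conjTranspose_eq_transpose_of_trivial] at hS
  refine ⟨S, hS, (Matrix.isUnit_iff_isUnit_det S).2 (Ne.isUnit fun h0 => hA.det_pos.ne' ?_)⟩
  rw [hS, Matrix.det_mul, Matrix.det_transpose, h0, mul_zero]

/-- **(b′) Clause "positive on the layer" in the line's currency** (`detArray m K A α` and `layer m K` unfolded):
for positive DEFINITE `A_l` every coefficient `[s^α] det Σ_l s_l A_l` with `Σ α = m` is `> 0` (so the support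
of the coefficient array is the whole layer `Δ(m,K)`). [folklore] -/
theorem detArray_pos_of_posDef (m K : ℕ) (A : Fin K → Matrix (Fin m) (Fin m) ℝ)
    (hA : ∀ l, (A l).PosDef) (α : Fin K → ℕ)
    (hα : α ∈ (Fintype.piFinset fun _ : Fin K => Finset.range (m + 1)).filter (fun α => ∑ i, α i = m)) :
    0 < MvPolynomial.coeff (Finsupp.equivFunOnFinite.symm α)
      (Matrix.det (∑ l, (MvPolynomial.X l : MvPolynomial (Fin K) ℝ) • (A l).map MvPolynomial.C)) := by
  classical
  choose S hS hU using fun l => exists_gram_of_posDef (hA l)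
  have hA' : A = fun l => (S l)ᵀ * S l := funext hS
  rw [hA']
  exact coeff_det_gram_pos S hU α (Finset.mem_filter.1 hα).2

/-! ### (c-definite) The whole layer is M-convex -/

/-- Two profiles with the same total that differ upwards at `i` differ downwards somewhere. [folklore] -/
theorem exists_lt_of_lt {α β : Fin K → ℕ} (hαβ : ∑ i, α i = ∑ i, β i) {i : Fin K} (hi : β i < α i) :
    ∃ j, α j < β j := by
  by_contra h
  push Not at h
  exact (Finset.sum_lt_sum (fun j _ => h j) ⟨i, Finset.mem_univ _, hi⟩).ne' hαβ

/-- The exchange `α − e_i + e_j` preserves the total when `α i ≥ 1`. [folklore] -/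
theorem sum_exch {α : Fin K → ℕ} {i : Fin K} (j : Fin K) (hi : 1 ≤ α i) :
    ∑ k, (α - Pi.single i 1 + Pi.single j 1 : Fin K → ℕ) k = ∑ k, α k := by
  simp only [Pi.add_apply, Pi.sub_apply]
  have hle : ∀ k ∈ (Finset.univ : Finset (Fin K)), (Pi.single i 1 : Fin K → ℕ) k ≤ α k := by
    intro k _
    rcases eq_or_ne k i with rfl | hk
    · rw [Pi.single_eq_same]; exact hi
    · rw [Pi.single_eq_of_ne hk]; exact Nat.zero_le _
  rw [Finset.sum_add_distrib, Finset.sum_tsub_distrib _ hle, Fintype.sum_pi_single', Fintype.sum_pi_single']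
  have := Finset.single_le_sum (fun k _ => Nat.zero_le (α k)) (Finset.mem_univ i)
  omega

/-- The exchange `α − e_i + e_j` of a layer point with `α i ≥ 1` stays in the layer (`layer m K` unfolded).
[folklore] -/
theorem exch_mem_layer {α : Fin K → ℕ} (hα : ∑ k, α k = m) {i : Fin K} (j : Fin K) (hi : 1 ≤ α i) :
    (α - Pi.single i 1 + Pi.single j 1 : Fin K → ℕ) ∈
      (Fintype.piFinset fun _ : Fin K => Finset.range (m + 1)).filter (fun α => ∑ i, α i = m) := by
  have hs : ∑ k, (α - Pi.single i 1 + Pi.single j 1 : Fin K → ℕ) k = m := by rw [sum_exch j hi, hα]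
  rw [Finset.mem_filter, Fintype.mem_piFinset]
  refine ⟨fun k => Finset.mem_range.2 (Nat.lt_succ_of_le ?_), hs⟩
  rw [← hs]
  exact Finset.single_le_sum (fun k _ => Nat.zero_le _) (Finset.mem_univ k)

/-- **(a)(b)(c) of `IsLorentzianArray m K (detArray m K A)` for positive DEFINITE `A_l`, in the line's currency**
(`detArray`, `layer`, `exch`, `IsMConvexOn … (fun _ => 0)` unfolded; the three conjuncts are literally the first
three conjuncts of the line's `IsLorentzianArray m K (detArray m K A)`): nonnegative coefficients, vanishing off
the layer, and the exchange axiom for the support — which for `A_l ≻ 0` is the whole layer by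
`detArray_pos_of_posDef`.  The fourth conjunct (Hessian signature) is NOT proved here. [folklore] -/
theorem isLorentzianArray_parts_abc_of_posDef (m K : ℕ) (A : Fin K → Matrix (Fin m) (Fin m) ℝ)
    (hA : ∀ l, (A l).PosDef) :
    (∀ α : Fin K → ℕ, 0 ≤ MvPolynomial.coeff (Finsupp.equivFunOnFinite.symm α)
      (Matrix.det (∑ l, (MvPolynomial.X l : MvPolynomial (Fin K) ℝ) • (A l).map MvPolynomial.C))) ∧
    (∀ α : Fin K → ℕ,
      α ∉ (Fintype.piFinset fun _ : Fin K => Finset.range (m + 1)).filter (fun α => ∑ i, α i = m) →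
      MvPolynomial.coeff (Finsupp.equivFunOnFinite.symm α)
        (Matrix.det (∑ l, (MvPolynomial.X l : MvPolynomial (Fin K) ℝ) • (A l).map MvPolynomial.C)) = 0) ∧
    (∀ α ∈ ((Fintype.piFinset fun _ : Fin K => Finset.range (m + 1)).filter (fun α => ∑ i, α i = m)).filter
        (fun α => MvPolynomial.coeff (Finsupp.equivFunOnFinite.symm α)
          (Matrix.det (∑ l, (MvPolynomial.X l : MvPolynomial (Fin K) ℝ) • (A l).map MvPolynomial.C)) ≠ 0),
      ∀ β ∈ ((Fintype.piFinset fun _ : Fin K => Finset.range (m + 1)).filter (fun α => ∑ i, α i = m)).filter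
        (fun α => MvPolynomial.coeff (Finsupp.equivFunOnFinite.symm α)
          (Matrix.det (∑ l, (MvPolynomial.X l : MvPolynomial (Fin K) ℝ) • (A l).map MvPolynomial.C)) ≠ 0),
      ∀ i : Fin K, β i < α i →
        ∃ j : Fin K, α j < β j ∧
          (α - Pi.single i 1 + Pi.single j 1) ∈
            ((Fintype.piFinset fun _ : Fin K => Finset.range (m + 1)).filter (fun α => ∑ i, α i = m)).filter
              (fun α => MvPolynomial.coeff (Finsupp.equivFunOnFinite.symm α)
                (Matrix.det (∑ l, (MvPolynomial.X l : MvPolynomial (Fin K) ℝ) • (A l).map MvPolynomial.C)) ≠ 0) ∧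
          (β - Pi.single j 1 + Pi.single i 1) ∈
            ((Fintype.piFinset fun _ : Fin K => Finset.range (m + 1)).filter (fun α => ∑ i, α i = m)).filter
              (fun α => MvPolynomial.coeff (Finsupp.equivFunOnFinite.symm α)
                (Matrix.det (∑ l, (MvPolynomial.X l : MvPolynomial (Fin K) ℝ) • (A l).map MvPolynomial.C)) ≠ 0) ∧
          (0 : ℚ) + 0 ≤ 0 + 0) := by
  classical
  -- (b): off the layer the coefficient vanishes — p7's `DetLorentzian.detArray_eq_zero_of_not_mem_layer`
  -- (degree-`m` homogeneity, `DetCurve.det_genericPencil_isHomogeneous`)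
  have hb := DetLorentzian.detArray_eq_zero_of_not_mem_layer m K A
  -- (a): p7's `DetLorentzian.detArray_nonneg_of_posSemidef` (Cauchy–Binet sum of squares)
  refine ⟨fun α => DetLorentzian.detArray_nonneg_of_posSemidef m K A (fun l => (hA l).posSemidef) α, hb, ?_⟩
  intro α hα β hβ i hi
  have hαL := (Finset.mem_filter.1 hα).1
  have hβL := (Finset.mem_filter.1 hβ).1
  have hαs : ∑ k, α k = m := (Finset.mem_filter.1 hαL).2
  have hβs : ∑ k, β k = m := (Finset.mem_filter.1 hβL).2
  obtain ⟨j, hj⟩ := exists_lt_of_lt (hαs.trans hβs.symm) hi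
  have hαe := exch_mem_layer hαs j (by omega : 1 ≤ α i)
  have hβe := exch_mem_layer hβs i (by omega : 1 ≤ β j)
  exact ⟨j, hj, Finset.mem_filter.2 ⟨hαe, (detArray_pos_of_posDef m K A hA _ hαe).ne'⟩,
    Finset.mem_filter.2 ⟨hβe, (detArray_pos_of_posDef m K A hA _ hβe).ne'⟩, le_rfl⟩

end DetLorentzianDefinite

end Summit.ValiantsHypothesis.ValiantsHypothesis.Theorems.LacunarySymmetroidMatrixDescartes

end
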